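import Summits.RiemannHypothesis.RiemannHypothesis.Theses.WeilGroundState
import Summits.RiemannHypothesis.RiemannHypothesis.Theorems.WeilGroundStateGroundStateMellinRealZeros
import Summits.RiemannHypothesis.RiemannHypothesis.Theorems.WeilGroundStateGroundStatesConvergeToXiStubMellinXi
import Summits.RiemannHypothesis.RiemannHypothesis.Theorems.WeilGroundStateGroundStatesConvergeToXiStubPsiDecay
import Literature.NumberTheory.LFunctions.WeilGroundState

/-!
# Disproof of `GroundStatesConvergeToXi` — findings (cdisprove cycle 1, 2026-08-16)

Crux (stmt-RiemannHypothesis-1527, route `WeilGroundState`, rank 3):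
`∃ a_k → ∞, ∃ u_k, ∃ c_k ≠ 0, (∀ k, IsWeilGroundState (a k) (u k)) ∧
   TendstoLocallyUniformlyOn (k s ↦ c_k · weilMellin (u k) s) riemannXi atTop {0 < Re s < 1}`
(read back in `W.lean`: the inline window clause is VERBATIM `IsWeilGroundState`, `Iff` by
`simp only [defs]`).

## Verdict of this cycle: NO KILL — and why it resists

* The statement is the tree's (weakened: `∃` subsequence, free `c_k`, OPEN strip, locally
  uniform) rendering of the limit formula CONJECTURED in print (Connes–Consani–Moscovici,
  arXiv:2511.22755 §7 p.29; Suzuki arXiv:2606.09096 (1.2); Connes arXiv:2602.04022 Fact 6.4 proves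
  it for the prolate guess `k_λ`, not for the ground state).
* In the tree, `GroundStateMellinRealZeros` (C–vS Thm 6.1) and the `Assembly` are PROVED, so
  `GroundStateSimpleEven ∧ GroundStatesConvergeToXi → RiemannHypothesis` is a theorem
  (`groundStatesConvergeToXi_false_of_not_RH` below records the contrapositive).  Hence the crux
  is false under `¬RH ∧ GroundStateSimpleEven` — useless as a disproof — while under RH it is the
  CCM25 conjecture, for which the crux numerics (`Numerics-r1-k2.md`, job j015414) are strongly
  FAVOURABLE: at `a = 1.2425` the first ten zeros of `û_a` agree with the zeta ordinates to
  `≤ 1e-18`, `cos∠(u_a, P_aΦ) = 0.9997`, shape error on `[0,12]` halves per `Δa = 0.25`.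
  An unconditional disproof would therefore be a disproof of the (weak) CCM25 limit formula
  against that evidence; no finite computation can deliver it (the statement is asymptotic in `a`
  and `∃` over subsequences and normalisations), and no structural/junk defect exists (below).
* JUNK AUDIT (all clean): `∫ ‖g n − u k‖²` is a genuine integral (`L²` data);
  `weilGroundEnergy (a k)` is a genuine infimum (`bddBelow` + nonempty sphere, tree);
  `u k = 0` a.e. off `[-a_k, a_k]` (`IsWeilGroundState.ae_eq_zero_of_notMem`) so
  `weilMellin (u k)` is entire; `∫‖u k‖² = 1` (no zero witness); the target `riemannXi` is the
  genuine completed `ξ` (`riemannXi_zero = 1/2`, entire, `ξ(1-s) = ξ(s)`).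
* VACUITY: not applicable (`∃`-statement).  Non-vacuity of the witness TYPE: ground states exist
  at every window modulo the CCM25 compactness fact (grounder note:
  `ConnesConsaniMoscovici2025_thm_3_6.exists_isWeilGroundState`), and the convergence clause ALONE
  (without the ground-state constraint) is satisfiable by truncations of Riemann's kernel `Φ`
  (PROVED in §B′; all the content sits in the conjunction).

## Index of the Lean content

* §A `groundStatesConvergeToXi_false_of_not_RH` — the crux is false modulo
  `GroundStateSimpleEven ∧ ¬RH` (in-tree contrapositive; NOT filed as a negative-modulo lemma:
  `H` contains `¬RH`).
* §B LOAD-BEARING ANALYSIS of the `∃`-clauses: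
  - `eventually_ne_zero_of_tendsto_riemannXi` — the conjunct `c k ≠ 0` is IMPLIED for all large
    `k` by the convergence clause (ξ ≢ 0 on the strip); it carries no content (planner may drop it
    after re-indexing; harmless as is).
  - (prose) `Tendsto a atTop atTop` vs exact equality: see §C.
  - §B′ `convergenceClauseWithoutGroundState_holds` (sorry-free; landed as proposal p100378,
    `Theorems/GroundStatesConvergeToXi/Negative/ConvergenceClauseNonVacuous.lean`): the ground-state clause is
    where ALL content lives — `a_k = k+1`, `u_k := Φ·𝟙_{[-k-1,k+1]}`, `c_k := 1` satisfy every
    other clause (window support, `L²`, `a_k → ∞`, `c_k ≠ 0`) with convergence even UNIFORM on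
    the whole open strip (`tendstoUniformlyOn_weilMellin_truncatedPhi`:
    `|ξ(s) − û_k(s)| ≤ ∫_{|t|>k+1} |Φ| e^{|t|/2} → 0`; `weilMellin Φ = ξ` is the landed stub
    `stub_mellinXi`).  Non-vacuity witness for the `∃`-shell minus the crux's hard constraint.
* §C NATURAL STRENGTHENING REFUTED (landed as proposal p98487,
  `Theorems/GroundStatesConvergeToXi/Negative/NotAttained.lean`; proofs duplicated here so that
  this work file is self-contained until the proposal is applied):
  `exists_const_mul_weilMellin_ne_riemannXi`, `not_eqOn_strip_of_isWeilGroundState`,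
  `not_exists_groundState_weilMellin_eq_riemannXi` — for EVERY integrable `u` vanishing a.e. on a
  right half-line (every ground state of every window, every windowed `L²` function) and every
  `c`, `c · weilMellin u ≠ ξ` somewhere on the critical line.  So "ξ is reproduced exactly at some
  window" is false; the crux is irreducibly asymptotic; every approximant of every witness is at
  positive distance from `ξ` on compact pieces of the line.
* §D LINE `Sketch` (lead prover-line-…-1527-0; `Lines/Sketch.lean`): stubs 1–4 are LANDED
  (RH-free transfer: Ψ-decay, `Φ̂ = ξ`, weak+tight ⇒ pointwise, pointwise+tight ⇒ locally uniform
  via Vitali).  The single open stub C⁺ = `stub_tightWeakLimit` (tight in every `L¹(e^{b|t|})`,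
  `b < 1/2`, + weak convergence of `c_k u_k` to `Φ = 2Ψ(2·)`) carries the whole content.
  Attacks on C⁺ (no kill):  (i) normalisation `Φ = 2Ψ(2t)`: correct (`stub_mellinXi` landed;
  numerics `∫Φ = ξ(1/2)` to 12 digits);  (ii) weak-vs-tight: abstractly, weak convergence against
  `C_c^∞` tests is blind to mass escaping to the window edges, so tightness is NOT implied by weak
  convergence (escaping bumps `e^{k/2}ψ(·−k)`), and conversely the crux's conclusion does not
  imply tightness (fast-oscillating edge bumps) — but for honest ground states neither scenario
  can be instantiated without a construction of the ground state, which is the open problem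
  itself;  (iii) `b < 1/2` is exactly what the open strip needs (compacts approach `Re s = 0, 1`);
  numerics even show convergence AT the pole points `s = 0, 1` (`F(iy)/F(0)` vs `ξ` to `4e-4` at
  `y = 1/2`, a = 1.2425), so no cheap obstruction at the strip boundary either;
  (iv) MUTATION: in stubs 3/4 the hypothesis `hu : ∀ k, IsWeilGroundState (a k) (u k)` is used
  only through `integrable`, `ae_eq_zero_of_notMem`, `differentiable_weilMellin` — "hu possibly
  unnecessary beyond: `u k ∈ L¹`, a.e. zero off a compact" (information for the lead: the
  transfer architecture is about windowed `L¹` functions, not about minimisers).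
* §E NEAR-MISSES: none.  Targets (`payload.stuck_stubs`): empty this cycle.

## For the provers (what the failed attacks say)
1. Nothing short of identifying `lim c_k u_k` with Riemann's kernel `Φ` in a topology that
   controls `∫ · e^{b|t|}` for all `b < 1/2` will do; §C shows the identification is never exact
   at a finite window, so rates matter (numerics: `W_Φ − W(u_a) ≈ 0.041 e^{-2a}`, shape error
   `∝ e^{-2.8a}`, consistent with Connes' `cλ^{-1/2-α}` for the prolate guess).
2. The only RH-free handle in print on the true ground state at LARGE `a` is variational
   (Bombieri 2000 §4, EL equation (4.2)) plus CCM25 Thm 3.6 (compactness); every other printed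
   statement about `θ_x ≈ k_λ` is conjectural (CCM25 §8 "missing step 2").
-/

set_option linter.dupNamespace false

noncomputable section

open MeasureTheory Complex Filter Set
open scoped Real Topology FourierTransform

namespace Summit.RiemannHypothesis.RiemannHypothesis.Cruxes.GroundStatesConvergeToXi.Disproof

open Literature.NumberTheory.LFunctions
open Summit.RiemannHypothesis.RiemannHypothesis.Theses.WeilGroundState
open Summit.RiemannHypothesis.RiemannHypothesis.Theorems
open Summit.RiemannHypothesis.RiemannHypothesis.Theorems.GroundStatesConvergeToXi

/-! ## §A  The crux is RH-hard in the tree -/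

/-- **In-tree contrapositive of the assembly**: since `GroundStateMellinRealZeros` (C–vS Thm 6.1)
is PROVED (`groundStateMellinRealZeros_proof`) and `closes` is the deciding theorem of the route,
the crux is false as soon as `GroundStateSimpleEven` holds and RH fails.  (Documentation only:
`H = GroundStateSimpleEven ∧ ¬RH` is not a constructible hypothesis, so this is NOT filed as a
negative-modulo lemma.) [folklore] -/
theorem groundStatesConvergeToXi_false_of_not_RH (h₁ : GroundStateSimpleEven)
    (hRH : ¬ _root_.RiemannHypothesis) : ¬ GroundStatesConvergeToXi :=
  fun h => hRH (closes h₁ groundStateMellinRealZeros_proof h)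

/-! ## §B  Load-bearing analysis of the `∃`-clauses -/

/-- `ξ` does not vanish identically on the open critical strip (identity theorem from
`ξ(0) = 1/2`). [folklore] -/
theorem exists_mem_strip_riemannXi_ne_zero :
    ∃ s : ℂ, (0 < s.re ∧ s.re < 1) ∧ riemannXi s ≠ 0 := by
  by_contra h
  push Not at h
  have hUo : IsOpen {s : ℂ | 0 < s.re ∧ s.re < 1} :=
    (isOpen_lt continuous_const Complex.continuous_re).inter
      (isOpen_lt Complex.continuous_re continuous_const)
  have han : AnalyticOnNhd ℂ riemannXi Set.univ :=
    differentiable_riemannXi.differentiableOn.analyticOnNhd isOpen_univ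
  have hz₀ : ((1 : ℂ) / 2) ∈ {s : ℂ | 0 < s.re ∧ s.re < 1} := by
    constructor <;> norm_num
  have hev : riemannXi =ᶠ[𝓝 ((1 : ℂ) / 2)] 0 :=
    Filter.eventuallyEq_of_mem (hUo.mem_nhds hz₀) fun s hs => h s hs
  have hall := han.eqOn_zero_of_preconnected_of_eventuallyEq_zero isPreconnected_univ
    (Set.mem_univ _) hev
  have h0 := hall (Set.mem_univ (0 : ℂ))
  rw [riemannXi_zero] at h0
  norm_num at h0

/-- **The conjunct `c k ≠ 0` carries no content**: ANY sequences `F_k : ℂ → ℂ`, `c_k : ℂ` with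
`c_k · F_k → ξ` locally uniformly on the open strip have `c_k ≠ 0` for all large `k` (evaluate at
a point of the strip where `ξ ≠ 0`).  So in the crux the clause `c k ≠ 0` is implied, for a tail
of the sequence, by the convergence clause; it excludes nothing. [folklore] -/
theorem eventually_ne_zero_of_tendsto_riemannXi {F : ℕ → ℂ → ℂ} {c : ℕ → ℂ}
    (h : TendstoLocallyUniformlyOn (fun k s => c k * F k s) riemannXi atTop
      {s : ℂ | 0 < s.re ∧ s.re < 1}) :
    ∀ᶠ k in atTop, c k ≠ 0 := by
  obtain ⟨s₀, hs₀, hξ⟩ := exists_mem_strip_riemannXi_ne_zero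
  have hpt : Tendsto (fun k => c k * F k s₀) atTop (𝓝 (riemannXi s₀)) := h.tendsto_at hs₀
  filter_upwards [hpt.eventually_ne hξ] with k hk
  exact left_ne_zero_of_mul hk

/-- The crux with the conjunct `c k ≠ 0` DROPPED (every other clause verbatim). [folklore] -/
def GroundStatesConvergeToXiWithoutCNeZero : Prop :=
  ∃ a : ℕ → ℝ, ∃ u : ℕ → ℝ → ℂ, ∃ c : ℕ → ℂ, Tendsto a atTop atTop ∧
    (∀ k, 0 < a k ∧ IsWeilGroundState (a k) (u k)) ∧
    TendstoLocallyUniformlyOn (fun k s => c k * weilMellin (u k) s) riemannXi atTop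
      {s : ℂ | 0 < s.re ∧ s.re < 1}

/-- The crux implies its `c k ≠ 0`-free form (trivial direction; the converse holds after
discarding finitely many indices, by `eventually_ne_zero_of_tendsto_riemannXi` — recorded in
prose, the re-indexing is bookkeeping). [folklore] -/
theorem withoutCNeZero_of_crux (h : GroundStatesConvergeToXi) :
    GroundStatesConvergeToXiWithoutCNeZero := by
  obtain ⟨a, u, c, ha, hk, hlim⟩ := h
  exact ⟨a, u, c, ha, fun k => ⟨(hk k).1, (hk k).2.2⟩, hlim⟩

/-! ## §C  Natural strengthening refuted: `ξ` is attained at NO finite window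
(landed: proposal p98487, `Theorems/GroundStatesConvergeToXi/Negative/NotAttained.lean`) -/

/-- Each theta term of `Ψ(x)` is positive for `x ≥ 0` (`y = π(n+1)²eˣ ≥ π > 3/2`). [folklore] -/
theorem thetaTerm_psiPoly_pos {x : ℝ} (hx : 0 ≤ x) (n : ℕ) :
    0 < LagariasMontague.thetaTerm LagariasMontague.psiPoly n x := by
  have hw := LagariasMontague.pi_le_thetaWeight n
  have hwpos := LagariasMontague.thetaWeight_pos n
  have hex : 1 ≤ Real.exp x := Real.one_le_exp hx
  simp only [LagariasMontague.thetaTerm, LagariasMontague.eval_psiPoly]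
  refine mul_pos ?_ (Real.exp_pos _)
  have hy : 3 ≤ LagariasMontague.thetaWeight n * Real.exp x := by
    have h1 : 0 ≤ LagariasMontague.thetaWeight n * (Real.exp x - 1) :=
      mul_nonneg hwpos.le (sub_nonneg.2 hex)
    nlinarith [Real.pi_gt_three]
  nlinarith

/-- `Ψ(x) > 0` for `x ≥ 0`. [folklore] -/
theorem Psi_pos_of_nonneg {x : ℝ} (hx : 0 ≤ x) : 0 < LagariasMontague.Psi x :=
  (LagariasMontague.summable_thetaTerm _ x).tsum_pos (fun n => (thetaTerm_psiPoly_pos hx n).le) 0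
    (thetaTerm_psiPoly_pos hx 0)

/-- `‖g(t) e^{iτt}‖ = ‖g(t)‖` on the critical line. [folklore] -/
theorem norm_mul_cexp_criticalLine (z : ℂ) (τ t : ℝ) :
    ‖z * cexp ((1 / 2 + (τ : ℂ) * I - 1 / 2) * (t : ℂ))‖ = ‖z‖ := by
  have e : (1 / 2 + (τ : ℂ) * I - 1 / 2) * (t : ℂ) = ((τ * t : ℝ) : ℂ) * I := by
    push_cast
    ring
  rw [norm_mul, e, Complex.norm_exp_ofReal_mul_I, mul_one]

/-- Integrable functions have integrable Mellin integrands on the critical line. [folklore] -/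
theorem integrable_mul_cexp_criticalLine {g : ℝ → ℂ} (hg : Integrable g) (τ : ℝ) :
    Integrable fun t : ℝ => g t * cexp ((1 / 2 + (τ : ℂ) * I - 1 / 2) * (t : ℂ)) :=
  hg.norm.mono' (hg.aestronglyMeasurable.mul (Continuous.aestronglyMeasurable (by fun_prop)))
    (ae_of_all _ fun t => (norm_mul_cexp_criticalLine (g t) τ t).le)

/-- `𝓕 g (ξ) = weilMellin g (1/2 − 2πξ i)` for `g : ℝ → ℂ`. [folklore] -/
theorem fourier_eq_weilMellin (g : ℝ → ℂ) (ξ : ℝ) :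
    𝓕 g ξ = weilMellin g (1 / 2 + ((-2 * π * ξ : ℝ) : ℂ) * I) := by
  rw [Real.fourier_real_eq_integral_exp_smul, weilMellin]
  refine integral_congr_ae (ae_of_all _ fun v => ?_)
  dsimp only
  rw [smul_eq_mul, mul_comm]
  congr 1
  push_cast
  ring

/-- **`ξ ≠ c · û` on the critical line** for every integrable `u` vanishing a.e. on a right
half-line and every `c` (Fourier uniqueness against `Φ = 2Ψ(2·)`, `Φ̂ = ξ`, `Ψ > 0` on `[0,∞)`).
[folklore] -/
theorem exists_const_mul_weilMellin_ne_riemannXi {u : ℝ → ℂ} (hu : Integrable u) {a : ℝ}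
    (hzero : ∀ᵐ t ∂volume, a < t → u t = 0) (c : ℂ) :
    ∃ τ : ℝ, c * weilMellin u (1 / 2 + τ * I) ≠ riemannXi (1 / 2 + τ * I) := by
  by_contra h
  push Not at h
  set Φ : ℝ → ℂ := fun t => 2 * LagariasMontague.Psic (2 * t) with hΦ
  set u' : ℝ → ℂ := (Set.Iic a).indicator u with hu'
  have huu' : u =ᵐ[volume] u' := by
    filter_upwards [hzero] with t ht
    by_cases hta : t ≤ a
    · rw [hu', Set.indicator_of_mem (show t ∈ Set.Iic a from hta)]
    · rw [hu', Set.indicator_of_notMem (show t ∉ Set.Iic a from hta)]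
      exact ht (lt_of_not_ge hta)
  have hu'int : Integrable u' := hu.congr huu'
  have hΦint : Integrable Φ := by
    have := integrable_phi_mul_cexp stub_psiDecay.2 (1 / 2)
    simpa using this
  set w : ℝ → ℂ := fun t => c * u' t - Φ t with hw
  have hwint : Integrable w := (hu'int.const_mul c).sub hΦint
  have hmellin : ∀ τ : ℝ, weilMellin w (1 / 2 + τ * I) = 0 := by
    intro τ
    have h1 := integrable_mul_cexp_criticalLine hu'int τ
    have h2 := integrable_mul_cexp_criticalLine hΦint τ
    have h1' : Integrable fun t : ℝ =>
        c * u' t * cexp ((1 / 2 + (τ : ℂ) * I - 1 / 2) * (t : ℂ)) :=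
      (h1.const_mul c).congr (ae_of_all _ fun t => by simp only [mul_assoc])
    have hsplit : weilMellin w (1 / 2 + τ * I) =
        c * weilMellin u' (1 / 2 + τ * I) - weilMellin Φ (1 / 2 + τ * I) := by
      rw [← weilMellin_const_mul]
      unfold weilMellin
      rw [← integral_sub h1' h2]
      refine integral_congr_ae (ae_of_all _ fun t => ?_)
      simp only [hw]
      ring
    have hu'u : weilMellin u' (1 / 2 + τ * I) = weilMellin u (1 / 2 + τ * I) := by
      unfold weilMellin
      refine integral_congr_ae ?_
      filter_upwards [huu'] with t ht
      rw [ht]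
    rw [hsplit, hu'u, h τ, hΦ, weilMellin_phi_criticalLine, sub_self]
  have hF : 𝓕 w = 0 := by
    funext ξ
    rw [fourier_eq_weilMellin, Pi.zero_apply]
    exact_mod_cast hmellin (-2 * π * ξ)
  have hav : a < |a| + 1 := by linarith [le_abs_self a]
  have hwev : w =ᶠ[𝓝 (|a| + 1)] fun t => -Φ t := by
    filter_upwards [Ioi_mem_nhds hav] with t ht
    have hnot : t ∉ Set.Iic a := fun h' => absurd (Set.mem_Iic.1 h') (not_le.2 ht)
    simp only [hw, hu', Set.indicator_of_notMem hnot, mul_zero, zero_sub]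
  have hcont : ContinuousAt w (|a| + 1) :=
    (continuous_phi.neg.continuousAt).congr_of_eventuallyEq hwev
  have hinv := hwint.fourierInv_fourier_eq (by rw [hF]; exact integrable_zero _ _ _) hcont
  rw [hF] at hinv
  have hlhs : (𝓕⁻ (0 : ℝ → ℂ)) (|a| + 1) = 0 := by
    rw [Real.fourierInv_eq']
    simp
  have hwv : w (|a| + 1) = -Φ (|a| + 1) := hwev.self_of_nhds
  rw [hlhs, hwv, hΦ] at hinv
  have hpos : 0 < LagariasMontague.Psi (2 * (|a| + 1)) :=
    Psi_pos_of_nonneg (by positivity)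
  have hzeroΨ : (LagariasMontague.Psi (2 * (|a| + 1)) : ℂ) = 0 := by
    have h2 : (2 : ℂ) * LagariasMontague.Psic (2 * (|a| + 1)) = 0 := by
      simpa using hinv.symm
    simpa [LagariasMontague.Psic] using h2
  exact hpos.ne' (by exact_mod_cast hzeroΨ)

/-- **No ground state reproduces `ξ` on the strip** (the crux's limit is attained at no finite
stage, for no normalisation). [folklore] -/
theorem not_eqOn_strip_of_isWeilGroundState {a : ℝ} {u : ℝ → ℂ} (hu : IsWeilGroundState a u)
    (c : ℂ) :
    ¬ Set.EqOn (fun s => c * weilMellin u s) riemannXi {s : ℂ | 0 < s.re ∧ s.re < 1} := by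
  intro h
  have hz : ∀ᵐ t ∂volume, a < t → u t = 0 := by
    filter_upwards [hu.ae_eq_zero_of_notMem] with t ht hat
    exact ht fun hmem => absurd hmem.2 (not_le.2 hat)
  obtain ⟨τ, hτ⟩ := exists_const_mul_weilMellin_ne_riemannXi hu.integrable hz c
  refine hτ (h ?_)
  constructor <;> norm_num

/-- **Refuted strengthening**: "some window's ground state has `c · û = ξ` on the strip" is
false. [folklore] -/
theorem not_exists_groundState_weilMellin_eq_riemannXi :
    ¬ ∃ a : ℝ, ∃ u : ℝ → ℂ, ∃ c : ℂ, IsWeilGroundState a u ∧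
      ∀ s : ℂ, 0 < s.re → s.re < 1 → c * weilMellin u s = riemannXi s := by
  rintro ⟨a, u, c, hu, h⟩
  exact not_eqOn_strip_of_isWeilGroundState hu c fun s hs => h s hs.1 hs.2

/-- **Consequence for witnesses of the crux**: for ANY witness `(a, u, c)` and every index `k`,
the `k`-th approximant is not yet `ξ` — there is a point of the critical line where
`c_k · û_k ≠ ξ`.  (The convergence in the crux is irreducibly a limit statement.) [folklore] -/
theorem approximant_ne_riemannXi {a : ℕ → ℝ} {u : ℕ → ℝ → ℂ} {c : ℕ → ℂ}
    (hu : ∀ k, IsWeilGroundState (a k) (u k)) (k : ℕ) :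
    ∃ τ : ℝ, c k * weilMellin (u k) (1 / 2 + τ * I) ≠ riemannXi (1 / 2 + τ * I) := by
  refine exists_const_mul_weilMellin_ne_riemannXi (hu k).integrable (a := a k) ?_ (c k)
  filter_upwards [(hu k).ae_eq_zero_of_notMem] with t ht hat
  exact ht fun hmem => absurd hmem.2 (not_le.2 hat)

/-! ## §B′  Non-vacuity of the analytic half: the convergence clause ALONE is satisfiable
(drop `IsWeilGroundState`, keep window support, `L²`, `a_k → ∞`, `c_k ≠ 0`): truncations of
Riemann's kernel `Φ = 2Ψ(2·)` converge to `ξ` even UNIFORMLY on the whole open strip.  So every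
bit of content of the crux is in the identification "renormalised ground states ≈ Φ". -/

/-- `Φ` is bounded: `‖Φ(t)‖ ≤ M`. [folklore] -/
theorem exists_norm_phi_le :
    ∃ M : ℝ, 0 ≤ M ∧ ∀ t : ℝ, ‖(2 : ℂ) * LagariasMontague.Psic (2 * t)‖ ≤ M := by
  obtain ⟨C, hC⟩ := stub_psiDecay.1 0
  refine ⟨2 * |C|, by positivity, fun t => ?_⟩
  rw [norm_phi]
  have h := hC (2 * t)
  simp only [zero_mul, neg_zero, Real.exp_zero, mul_one] at h
  nlinarith [abs_nonneg (LagariasMontague.Psi (2 * t)), le_abs_self C]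

/-- `Φ ∈ L¹(ℝ)`. [folklore] -/
theorem integrable_phi : Integrable (fun t : ℝ => (2 : ℂ) * LagariasMontague.Psic (2 * t)) := by
  simpa using integrable_phi_mul_cexp stub_psiDecay.2 (1 / 2)

/-- `Φ ∈ L²(ℝ)` (bounded and integrable). [folklore] -/
theorem memLp_phi : MemLp (fun t : ℝ => (2 : ℂ) * LagariasMontague.Psic (2 * t)) 2 := by
  obtain ⟨M, hM0, hM⟩ := exists_norm_phi_le
  refine (memLp_two_iff_integrable_sq_norm integrable_phi.aestronglyMeasurable).2 ?_
  refine (integrable_phi.norm.const_mul M).mono'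
    ((continuous_phi.norm.pow 2).aestronglyMeasurable) (ae_of_all _ fun t => ?_)
  rw [Real.norm_of_nonneg (by positivity), sq]
  exact mul_le_mul_of_nonneg_right (hM t) (norm_nonneg _)

/-- The weight `‖Φ(t)‖ e^{|t|/2}` is integrable (exponential moments of `Ψ`). [folklore] -/
theorem integrable_norm_phi_mul_exp_half :
    Integrable fun t : ℝ => ‖(2 : ℂ) * LagariasMontague.Psic (2 * t)‖ * Real.exp (|t| / 2) := by
  refine (((stub_psiDecay.2 (1 / 2)).norm).const_mul 2).congr (ae_of_all _ fun t => ?_)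
  dsimp only
  rw [norm_phi, Real.norm_eq_abs, abs_mul, abs_of_pos (Real.exp_pos _)]
  have : (1 / 2 : ℝ) * |t| = |t| / 2 := by ring
  rw [this]
  ring

/-- On the open strip the Mellin weight is dominated by `e^{|t|/2}`:
`‖e^{(s-1/2)t}‖ ≤ e^{|t|/2}` for `0 < Re s < 1`. [folklore] -/
theorem norm_cexp_le_exp_half {s : ℂ} (hs : 0 < s.re ∧ s.re < 1) (t : ℝ) :
    ‖cexp ((s - 1 / 2) * (t : ℂ))‖ ≤ Real.exp (|t| / 2) := by
  rw [Complex.norm_exp, Real.exp_le_exp]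
  have hre : ((s - 1 / 2) * (t : ℂ)).re = (s.re - 1 / 2) * t := by
    simp [Complex.mul_re]
  rw [hre]
  have h1 : |s.re - 1 / 2| ≤ 1 / 2 := abs_le.2 ⟨by linarith [hs.1], by linarith [hs.2]⟩
  calc (s.re - 1 / 2) * t ≤ |(s.re - 1 / 2) * t| := le_abs_self _
    _ = |s.re - 1 / 2| * |t| := abs_mul _ _
    _ ≤ 1 / 2 * |t| := mul_le_mul_of_nonneg_right h1 (abs_nonneg t)
    _ = |t| / 2 := by ring

/-- **Truncations of `Φ` have Mellin transforms converging to `ξ` UNIFORMLY on the open strip**: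
`|ξ(s) − (Φ𝟙_{[-k-1,k+1]})^(s)| ≤ ∫_{|t|>k+1} ‖Φ‖ e^{|t|/2} → 0`. [folklore] -/
theorem tendstoUniformlyOn_weilMellin_truncatedPhi :
    TendstoUniformlyOn
      (fun (k : ℕ) (s : ℂ) => weilMellin ((Icc (-((k : ℝ) + 1)) ((k : ℝ) + 1)).indicator
        (fun t : ℝ => (2 : ℂ) * LagariasMontague.Psic (2 * t))) s)
      riemannXi atTop {s : ℂ | 0 < s.re ∧ s.re < 1} := by
  set Φ : ℝ → ℂ := fun t => 2 * LagariasMontague.Psic (2 * t) with hΦ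
  set g : ℝ → ℝ := fun t => ‖Φ t‖ * Real.exp (|t| / 2) with hg
  have hgint : Integrable g := integrable_norm_phi_mul_exp_half
  set I : ℕ → Set ℝ := fun k => Icc (-((k : ℝ) + 1)) ((k : ℝ) + 1) with hI
  have hIm : ∀ k, MeasurableSet (I k) := fun k => measurableSet_Icc
  -- the tail functional `T k = ∫_{(I k)ᶜ} g → 0`
  set T : ℕ → ℝ := fun k => ∫ t, (I k)ᶜ.indicator g t with hT
  have hT : Tendsto T atTop (𝓝 0) := by
    have h := tendsto_integral_of_dominated_convergence (μ := volume) (bound := g)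
      (F := fun k t => (I k)ᶜ.indicator g t) (f := fun _ => (0 : ℝ))
      (fun k => (hgint.aestronglyMeasurable.indicator (hIm k).compl)) hgint
      (fun k => ae_of_all _ fun t => by
        rw [Real.norm_eq_abs, Set.indicator_apply]
        split_ifs
        · exact (abs_of_nonneg (by positivity)).le
        · simpa using (show 0 ≤ g t by positivity))
      (ae_of_all _ fun t => by
        refine tendsto_const_nhds.congr' ?_
        filter_upwards [eventually_gt_atTop ⌈|t|⌉₊] with k hk
        have hk' : |t| < (k : ℝ) + 1 := by
          have := Nat.le_ceil |t|
          have hk2 : (⌈|t|⌉₊ : ℝ) < k := by exact_mod_cast hk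
          linarith
        have hmem : t ∈ I k := by
          simp only [hI, mem_Icc]
          constructor <;> linarith [le_abs_self t, neg_abs_le t]
        rw [Set.indicator_of_notMem (Set.notMem_compl_iff.2 hmem)])
    simpa using h
  rw [Metric.tendstoUniformlyOn_iff]
  intro ε hε
  filter_upwards [hT.eventually (eventually_lt_nhds hε)] with k hk s hs
  -- `ξ(s) − (Φ𝟙)^(s) = ∫ 𝟙_{(I k)ᶜ} Φ e^{(s-1/2)t}`
  have h1 : Integrable fun t : ℝ => Φ t * cexp ((s - 1 / 2) * t) :=
    integrable_phi_mul_cexp stub_psiDecay.2 s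
  have h2 : Integrable fun t : ℝ => (I k).indicator Φ t * cexp ((s - 1 / 2) * t) := by
    refine (h1.indicator (hIm k)).congr (ae_of_all _ fun t => ?_)
    simp only [Set.indicator_apply]
    split_ifs <;> simp
  have hdiff : riemannXi s - weilMellin ((I k).indicator Φ) s =
      ∫ t : ℝ, (I k)ᶜ.indicator Φ t * cexp ((s - 1 / 2) * t) := by
    rw [← stub_mellinXi stub_psiDecay.1 stub_psiDecay.2 s]
    unfold weilMellin
    rw [← integral_sub h1 h2]
    refine integral_congr_ae (ae_of_all _ fun t => ?_)
    dsimp only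
    rw [Set.indicator_compl, Pi.sub_apply]
    ring
  rw [dist_eq_norm, hdiff]
  calc ‖∫ t : ℝ, (I k)ᶜ.indicator Φ t * cexp ((s - 1 / 2) * t)‖
      ≤ ∫ t : ℝ, ‖(I k)ᶜ.indicator Φ t * cexp ((s - 1 / 2) * t)‖ :=
        norm_integral_le_integral_norm _
    _ ≤ ∫ t : ℝ, (I k)ᶜ.indicator g t := by
        refine integral_mono_of_nonneg (ae_of_all _ fun t => norm_nonneg _)
          (hgint.indicator (hIm k).compl) (ae_of_all _ fun t => ?_)
        simp only [Set.indicator_apply, hg]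
        split_ifs with ht
        · rw [norm_mul]
          exact mul_le_mul_of_nonneg_left (norm_cexp_le_exp_half hs t) (norm_nonneg _)
        · simp
    _ = T k := rfl
    _ < ε := hk

/-- The crux with the ground-state constraint REPLACED by mere window data (`L²`, a.e. zero off
`[-a_k, a_k]`) — every other clause verbatim. [folklore] -/
def ConvergenceClauseWithoutGroundState : Prop :=
  ∃ a : ℕ → ℝ, ∃ u : ℕ → ℝ → ℂ, ∃ c : ℕ → ℂ, Tendsto a atTop atTop ∧
    (∀ k, 0 < a k ∧ c k ≠ 0 ∧ MemLp (u k) 2 ∧ ∀ t, t ∉ Icc (-(a k)) (a k) → u k t = 0) ∧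
    TendstoLocallyUniformlyOn (fun k s => c k * weilMellin (u k) s) riemannXi atTop
      {s : ℂ | 0 < s.re ∧ s.re < 1}

/-- **The convergence clause without the ground-state constraint HOLDS** (witness:
`a_k = k + 1`, `u_k = Φ𝟙_{[-k-1,k+1]}`, `c_k = 1`; convergence is even uniform on the strip).
Hence the crux is exactly as hard as "renormalised ground states approximate `Φ`"; its
analytic/formal shell excludes nothing and admits nothing for free. [folklore] -/
theorem convergenceClauseWithoutGroundState_holds : ConvergenceClauseWithoutGroundState := by
  refine ⟨fun k => (k : ℝ) + 1,
    fun k => (Icc (-((k : ℝ) + 1)) ((k : ℝ) + 1)).indicator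
      (fun t : ℝ => (2 : ℂ) * LagariasMontague.Psic (2 * t)),
    fun _ => 1, ?_, fun k => ⟨by positivity, one_ne_zero, ?_, fun t ht => ?_⟩, ?_⟩
  · exact tendsto_atTop_add_const_right _ 1 tendsto_natCast_atTop_atTop
  · exact memLp_phi.indicator measurableSet_Icc
  · exact Set.indicator_of_notMem ht _
  · have e : (fun (k : ℕ) (s : ℂ) => (1 : ℂ) * weilMellin ((Icc (-((k : ℝ) + 1)) ((k : ℝ) + 1)).indicator
        (fun t : ℝ => (2 : ℂ) * LagariasMontague.Psic (2 * t))) s) =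
        fun (k : ℕ) (s : ℂ) => weilMellin ((Icc (-((k : ℝ) + 1)) ((k : ℝ) + 1)).indicator
        (fun t : ℝ => (2 : ℂ) * LagariasMontague.Psic (2 * t))) s := by
      funext k s
      exact one_mul _
    rw [e]
    exact tendstoUniformlyOn_weilMellin_truncatedPhi.tendstoLocallyUniformlyOn

-- Targets: none this cycle (payload.stuck_stubs = []); line `Sketch` has one open stub, C⁺
-- (`stub_tightWeakLimit`), which is the crux's content in position space (see module docstring §D).

end Summit.RiemannHypothesis.RiemannHypothesis.Cruxes.GroundStatesConvergeToXi.Disproof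

end
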